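import Mathlib.CategoryTheory.SingleObj
import Mathlib.CategoryTheory.PUnit
import Literature.AnabelianGeometry.EtaleTheta.TemperedFrobenioidToyTwoPrimes
import Literature.AnabelianGeometry.EtaleTheta.TemperedFrobenioidCor38Sub
import HarnessLib

/-!
# [EtTh] Cor. 3.8, proof rows `BaseSquare` / `BaseSquareInv` / `PreservesLinear` / `PreservesBsFldPreSteps`
# over the typed record `Cor38Hyp`: the bare universal closures DECIDED (kernel certificates)

S. Mochizuki, *The étale theta function and its Frobenioid-theoretic manifestations*, Publ. RIMS **45**
(2009) [MochizukiEtTh2009], Cor. 3.8 (ii) and its proof, PDF p. 81 l. 5–8 / l. 14–15: "By applying …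
[Mzk17], Corollary 4.11, (ii), in the case of assertion (ii), it follows that `Ψ` preserves the submonoids
'`O^▷(−)`' … Thus, `Ψ` preserves the base-field-theoretic pre-steps" [cite: MochizukiEtTh2009, Cor 3.8 p.81];
S. Mochizuki, *The geometry of Frobenioids I*, Kyushu J. Math. **62** (2008), Cor. 4.11 (ii) p. 91: "Suppose
further that `D₁`, `D₂` are *Div-slim* … Then there exists a 1-unique functor `Ψ^Base : D₁ → D₂` …"
[cite: MochizukiFrdI2008, Cor. 4.11 (ii) p.91].

abc-iut cell, block F (FACT-LIST fact-proving wave), seat abc-iut-f-134, tranche 134: rows **F-2813**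
`Cor38Hyp.BaseSquare`, **F-2814** `Cor38Hyp.BaseSquareInv`, **F-2815** `Cor38Hyp.PreservesLinear`, **F-2816**
`Cor38Hyp.PreservesBsFldPreSteps` of abc-iut-w5-d124's statements-first sub-DAG `TemperedFrobenioidCor38Sub.lean`
(class `preparatory`, kernel_closedness `parametrised`: the parameter is a record `h : Cor38Hyp C₁ C₂` = an
ARBITRARY equivalence `Ψ : C₁ ≌ C₂` of the underlying categories + "`D_i` of FSMFF-type" + "`Φ_i` non-dilating",
over FREE [FrdI] vocabularies).  The INSTANCE forms the Cor. 3.8 knits consume are abc-iut-f-001's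
`Cor38Hyp.baseSquare_treeCatVocab_of_isOfFSMType` / `baseSquareInv_treeCatVocab_of_isOfFSMType` (p430236) and
`preservesLinear_treeCatVocab` / `preservesBsFldPreSteps_treeCatVocab_of_isFrobeniusSlim` / `…_of_baseSquares`
(p430635), at the canonical vocabulary.  THIS file decides the bare universal closures (cell rule R5), by two
kernel certificates:

§A — at abc-iut-f-015's two-structures-one-category pair `TwoPrimes.hyp` (`Ψ = 𝟭` between the structures
`C 1`, `C 0` on ONE model Frobenioid, `ℝ·Φ₀^cnst` along `e₀` resp. `e₁`): the base-identity pre-step `φ`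
with zero divisor `e₀` is base-field-theoretic for `C 1` and not for `C 0`, so **F-2816 FAILS at `hyp`**
(`TwoPrimes.not_preservesBsFldPreSteps`) and its universal closure is FALSE
(`TwoPrimes.not_forall_preservesBsFldPreSteps`); at the same `hyp`, F-2813/F-2814/F-2815 HOLD
(`TwoPrimes.baseSquare_hyp`, `baseSquareInv_hyp`, `preservesLinear_hyp` — the base is the one-object category).

§B — the **Frobenius-degree twist**.  Over the NON-SLIM one-object base `D := SingleObj G` (`G` a commutative
group; a groupoid, hence of FSM-, hence FSMFF-type) the same Def. 3.3 (iii)/3.6 (i) data (`TwoPrimes.realified 0`,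
pulled back along `D → D₀ = •`) give a typed tempered Frobenioid `DegreeTwist.C G` whose category — the model
Frobenioid of CONSTANT data over `SingleObj G` — carries, for every homomorphism `ε : ℕ_{≥1} → G`, the
autoequivalence `twist ε : (d, g, z, u) ↦ (d, g·ε(d), z, u)` (identity on objects; a functor because `deg_Fr`
is multiplicative and the pull-backs of the constant monoids ignore `g`).  If `ε(2) ≠ 1`, NO functor
`D → D` makes the base square of `twist ε` `1`-commute (`not_oneCommutes_twist`: test it on the degree-`2`
Frobenius endomorphism `(2, 1, 0, 1)` of the Frobenius-trivial object), so **F-2813 and F-2814 FAIL at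
`DegreeTwist.hyp ε`** (`not_baseSquare`, `not_baseSquareInv`) and their universal closures are FALSE
(`not_forall_baseSquare`, `not_forall_baseSquareInv`, at `G = ℚˣ`, `ε(d) = d`); at the same record F-2815 and
F-2816 HOLD (`preservesLinear_hyp`, `preservesBsFldPreSteps_hyp`).  This is exactly the phenomenon that the
Div-slimness hypothesis of [FrdI] Cor. 4.11 (ii) (the case (ii) hypothesis of Cor. 3.8) excludes: a base with
central automorphisms acting trivially on `Φ`, `B`.

Reading (cell vocabulary, R5): the four rows are admissible ONLY as their instance forms (above); F-2815's bare
closure is not decided here (both certificates preserve `deg_Fr`).  The gaps exhibited are SCHEMA gaps of OUR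
typed interfaces (`Cor38Hyp` carries neither the slimness of `D_i` nor the tie of `ℝ·Φ₀^cnst` to the category),
not claims about the tempered Frobenioids of a curve or about Cor. 3.8 / Cor. 4.11 as printed.  HONEST FRAMING:
refereed pre-IUT material; nothing here bears on the disputed [IUTchIII] Cor. 3.12; no side taken; typed ≠ proved.
-/

noncomputable section

namespace Literature.AnabelianGeometry.EtaleTheta

open CategoryTheory Opposite Literature.AlgebraicGeometry.Frobenioids

/-! ### §A  Rows F-2813 – F-2816 at the two-structures-one-category pair `TwoPrimes.hyp` (`Ψ = 𝟭`) -/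

namespace TwoPrimes

/-- The base-identity endomorphism `φ = (1, id, e₀, (e₀, e₀))` is a pre-step (linear base-isomorphism).
[cite: MochizukiFrdI2008, Def. 1.2 (iii) p.22] -/
theorem isPreStep_φ : (C 1).opsData.IsPreStep φ :=
  ⟨rfl, by change IsIso (𝟙 _); infer_instance⟩

/-- **Row F-2816 FAILS at `hyp`**: `Ψ = 𝟭 : C 1 ⥲ C 0` does not preserve the base-field-theoretic pre-steps
(`φ` is one for `C 1`, its image `φ` is not one for `C 0`). [cite: MochizukiEtTh2009, Cor 3.8 p.81] -/
theorem not_preservesBsFldPreSteps : ¬ hyp.PreservesBsFldPreSteps :=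
  fun h => not_isBaseFieldTheoretic_φ ((h.1 φ isPreStep_φ).1 isBaseFieldTheoretic_φ)

/-- **F-2816 as typed is not a fact over ALL `Cor38Hyp` records:** the universal closure (universe level `0`)
is FALSE.  Instance forms: `Cor38Hyp.preservesBsFldPreSteps_treeCatVocab_of_isFrobeniusSlim` /
`…_of_baseSquares` (abc-iut-f-001), `preservesBsFldPreSteps_of_criterion`. [cite: MochizukiEtTh2009, Cor 3.8 p.81] -/
theorem not_forall_preservesBsFldPreSteps :
    ¬ ∀ {D₀ : Type} [Category.{0} D₀] {V : FrdIMonoidStub.{0}} {T : RealifiedDivisorMonoids (D₀ := D₀) V}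
        {D : Type} [Category.{0} D] {VD : FrdICatStub.{0, 0, 0} D}
        {D₀' : Type} [Category.{0} D₀'] {T' : RealifiedDivisorMonoids (D₀ := D₀') V}
        {D' : Type} [Category.{0} D'] {VD' : FrdICatStub.{0, 0, 0} D'}
        {C₁ : TemperedFrobenioid T D VD} {C₂ : TemperedFrobenioid T' D' VD'} (h : Cor38Hyp C₁ C₂),
        h.PreservesBsFldPreSteps :=
  fun h => not_preservesBsFldPreSteps (h hyp)

/-- Row F-2815 HOLDS at `hyp` (`Ψ = 𝟭` preserves Frobenius degrees). [cite: MochizukiEtTh2009, Cor 3.8 p.81] -/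
theorem preservesLinear_hyp : hyp.PreservesLinear :=
  ⟨fun _ _ _ h => h, fun _ _ _ h => h⟩

/-- Row F-2813 HOLDS at `hyp`: over the one-object base every base square `1`-commutes `1`-uniquely
(`Ψ^Base := 𝟭`; all functors to `•` are isomorphic). [cite: MochizukiEtTh2009, Cor 3.8 p.81] -/
theorem baseSquare_hyp : hyp.BaseSquare :=
  ⟨𝟭 _, inferInstance, ⟨Functor.punitExt _ _⟩, fun _ _ => ⟨Functor.punitExt _ _⟩⟩

/-- Row F-2814 HOLDS at `hyp`, likewise. [cite: MochizukiEtTh2009, Cor 3.8 p.81] -/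
theorem baseSquareInv_hyp : hyp.BaseSquareInv :=
  ⟨𝟭 _, inferInstance, ⟨Functor.punitExt _ _⟩, fun _ _ => ⟨Functor.punitExt _ _⟩⟩

end TwoPrimes

/-! ### §B  The Frobenius-degree twist over a non-slim one-object base -/

namespace DegreeTwist

variable (G : Type) [CommGroup G]

/-- The trivial [FrdI] category vocabulary on the one-object base `SingleObj G`.
[cite: MochizukiEtTh2009, Def 3.6 p.77] -/
def catVocab : FrdICatStub.{0, 0, 0} (SingleObj G) where
  IsDivisorialOn _ := True
  IsRational _ := True
  IsStrictlyRational _ := True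

/-- `SingleObj G` is of FSM-type: it is a groupoid, so every (FSM-)morphism is an isomorphism.
[cite: MochizukiFrdI2008, §0 p.14] -/
theorem isOfFSMType : IsOfFSMType (SingleObj G) :=
  ⟨fun _ _ => inferInstance⟩

/-- `SingleObj G` is totally epimorphic (a groupoid). [cite: MochizukiFrdI2008, §0 p.14] -/
theorem isTotallyEpimorphic : IsTotallyEpimorphic (SingleObj G) :=
  ⟨fun _ => inferInstance⟩

/-- **The typed tempered Frobenioid over the non-slim base `SingleObj G`**: the Def. 3.3 (iii)/3.6 (i) data
`TwoPrimes.realified 0` (`Φ₀ = Φ₀^ℝ = ℤ_{≥0}²`, `B₀^Λ = (ℤ_{≥0}²)^gp`, `Div = id`, `ℝ·Φ₀^cnst = {g | g_0 = 0}`) pulled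
back along the unique functor `SingleObj G → •`; `Φ := Φ^{ℝ-log}` (so `G` acts trivially), `Φ^{bs-fld} = ℤ_{≥0}·e₁`
monoprime, Def. 3.6 (ii)(b) by the constant `e₁`. [cite: MochizukiEtTh2009, Def 3.6 p.77] -/
def C : TemperedFrobenioid (TwoPrimes.realified 0) (SingleObj G) (catVocab G) where
  isConnected := zigzag_isConnected fun _ _ => Relation.ReflTransGen.refl
  isTotallyEpimorphic := isTotallyEpimorphic G
  base := (Functor.const (SingleObj G)).obj ⟨PUnit.unit⟩
  Φ := ⟨fun _ => ⊤, fun _ _ _ => trivial⟩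
  isGroupSaturated A := (isGroupSaturated_iff' _).2 fun _ _ _ _ _ _ => trivial
  isPerfFactorial _ := trivial
  isDivisorialOn := trivial
  isMonoprime_bsFld _ := IsMonoprime.ofZ ⟨⟨TwoPrimes.bsFldEquiv 0⟩⟩
  exists_FΛ_div_ne _ := ⟨Algebra.GrothendieckGroup.of (TwoPrimes.e 1), by
      show TwoPrimes.ψ 0 (Algebra.GrothendieckGroup.of (TwoPrimes.e 1)) = 1
      rw [TwoPrimes.ψ_of_e, if_neg (by decide)]
      rfl,
    TwoPrimes.e 1, trivial, 1, trivial, TwoPrimes.e_ne_one _, by rw [map_one, div_one]; rfl⟩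

variable {G}

/-- **The Frobenius-degree twist** `twist ε : (d, g, z, u) ↦ (d, g·ε(d), z, u)`, identity on objects — a
functor of the model Frobenioid of the constant data over `SingleObj G` to itself (`deg_Fr` is multiplicative,
`G` is commutative, and the pull-backs of `Φ`, `B` do not see `g`). [cite: MochizukiFrdI2008, Thm. 5.2 (i) p.100] -/
def twist (ε : ℕ+ →* G) : (C G).category ⥤ (C G).category where
  obj X := X
  map {X Y} φ :=
    { degFr := ModelFrobenioid.degFr φ
      base := ModelFrobenioid.baseMap φ ≫ (show Y.base ⟶ Y.base from ε (ModelFrobenioid.degFr φ))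
      div := ModelFrobenioid.div φ
      unit := ModelFrobenioid.unit φ
      rel := ModelFrobenioid.rel φ }
  map_id X := by
    apply ModelFrobenioid.hom_ext
    · rfl
    · change ε 1 * (1 : G) = 1
      rw [map_one, mul_one]
    · rfl
    · rfl
  map_comp {X Y Z} φ ψ := by
    apply ModelFrobenioid.hom_ext
    · rfl
    · change ε (ModelFrobenioid.degFr ψ * ModelFrobenioid.degFr φ) *
          ((ModelFrobenioid.baseMap ψ : G) * (ModelFrobenioid.baseMap φ : G)) =
        (ε (ModelFrobenioid.degFr ψ) * (ModelFrobenioid.baseMap ψ : G)) *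
          (ε (ModelFrobenioid.degFr φ) * (ModelFrobenioid.baseMap φ : G))
      rw [map_mul, mul_mul_mul_comm]
    · rfl
    · rfl

/-- `deg_Fr`, `Div`, `u` are untouched by the twist; `Base` is multiplied by `ε(deg_Fr)`.
[cite: MochizukiFrdI2008, Thm. 5.2 (i) p.100] -/
theorem twist_map_base (ε : ℕ+ →* G) {X Y : (C G).category} (φ : X ⟶ Y) :
    (ModelFrobenioid.baseMap ((twist ε).map φ) : G) =
      ε (ModelFrobenioid.degFr φ) * (ModelFrobenioid.baseMap φ : G) := rfl

/-- Twisting by `ε` and then by `ε⁻¹` is the identity (componentwise the identity isomorphisms).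
[cite: MochizukiFrdI2008, Thm. 5.2 (i) p.100] -/
def twistCompIso (ε : ℕ+ →* G) : twist ε ⋙ twist ε⁻¹ ≅ 𝟭 (C G).category :=
  NatIso.ofComponents (fun X => Iso.refl X) fun {X Y} φ => by
    refine (Category.comp_id _).trans (Eq.trans ?_ (Category.id_comp _).symm)
    apply ModelFrobenioid.hom_ext
    · rfl
    · change (ε⁻¹) (ModelFrobenioid.degFr φ) * (ε (ModelFrobenioid.degFr φ) * (ModelFrobenioid.baseMap φ : G)) =
        (ModelFrobenioid.baseMap φ : G)
      rw [MonoidHom.inv_apply, inv_mul_cancel_left]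
    · rfl
    · rfl

/-- **The twist is an autoequivalence** of the category of the tempered Frobenioid (quasi-inverse: the twist
by `ε⁻¹`). [cite: MochizukiEtTh2009, Cor 3.8 p.80] -/
def twistEquiv (ε : ℕ+ →* G) : (C G).category ≌ (C G).category :=
  CategoryTheory.Equivalence.mk (twist ε) (twist ε⁻¹) (twistCompIso ε).symm
    (by simpa only [inv_inv] using twistCompIso ε⁻¹)

/-- **Every typed hypothesis of Cor. 3.8 holds for `Ψ := twist ε : C ⥲ C`**: the base `SingleObj G` is of
FSM-, hence FSMFF-type, and "non-dilating" reads `True` in the trivial vocabulary.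
[cite: MochizukiEtTh2009, Cor 3.8 p.80] -/
def hyp (ε : ℕ+ →* G) : Cor38Hyp (C G) (C G) where
  Ψ := twistEquiv ε
  fsmff := ⟨(isOfFSMType G).isOfFSMFFType, (isOfFSMType G).isOfFSMFFType⟩
  nonDilating := ⟨fun _ _ => trivial, fun _ _ => trivial⟩

/-- The Frobenius-trivial object `(•, 0)`. [cite: MochizukiFrdI2008, Thm. 5.2 (i) p.100] -/
abbrev X₀ : (C G).category := ⟨SingleObj.star G, 1⟩

/-- The Frobenius endomorphism `(n, 1, 0, 1)` of `(•, 0)` of degree `n`. [cite: MochizukiFrdI2008, Thm. 5.2 (i) p.100] -/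
def frob (n : ℕ+) : (X₀ : (C G).category) ⟶ X₀ where
  degFr := n
  base := 𝟙 _
  div := 1
  unit := 1
  rel := by
    change (1 : Algebra.GrothendieckGroup _) ^ (n : ℕ) * Algebra.GrothendieckGroup.of 1 =
      pullGp (C G).divisorMonoid (𝟙 _) 1 * divB _ _ (C G).divBNatTrans _ 1
    rw [map_one, map_one, map_one, one_pow, one_mul]

/-- **No functor `D → D` makes the base square of `twist ε` `1`-commute when `ε(2) ≠ 1`**: a natural
isomorphism `η : twist ε ⋙ Base ≅ Base ⋙ B'` would give, at the degree-`2` Frobenius endomorphism of `(•, 0)`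
(whose `Base` is the identity), `η · ε(2) = η` in `G`. [cite: MochizukiFrdI2008, Cor. 4.11 (ii) p.91] -/
theorem not_oneCommutes_twist {ε : ℕ+ →* G} (hε : ε 2 ≠ 1) (B' : SingleObj G ⥤ SingleObj G) :
    ¬ OneCommutes (twist ε) (C G).opsData.base (C G).opsData.base B' := by
  rintro ⟨η⟩
  have h := η.hom.naturality (frob 2)
  have h1 : ((C G).opsData.base ⋙ B').map (frob 2) = 𝟙 _ := B'.map_id _
  rw [h1, Category.comp_id] at h
  have h' : (η.hom.app X₀ : G) * (ε 2 * (1 : G)) = (η.hom.app X₀ : G) * 1 := h.trans (mul_one _).symm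
  exact hε ((mul_one _).symm.trans (mul_left_cancel h'))

/-- **Row F-2813 FAILS at `hyp ε`** (`ε(2) ≠ 1`): there is no `1`-commuting base square for `Ψ = twist ε`,
let alone a `1`-unique one. [cite: MochizukiEtTh2009, Cor 3.8 p.81] -/
theorem not_baseSquare {ε : ℕ+ →* G} (hε : ε 2 ≠ 1) : ¬ (hyp ε).BaseSquare :=
  fun ⟨B', _, hc, _⟩ => not_oneCommutes_twist hε B' hc

/-- **Row F-2814 FAILS at `hyp ε`** (`ε(2) ≠ 1`): the quasi-inverse is the twist by `ε⁻¹`, `ε⁻¹(2) ≠ 1`.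
[cite: MochizukiEtTh2009, Cor 3.8 p.81] -/
theorem not_baseSquareInv {ε : ℕ+ →* G} (hε : ε 2 ≠ 1) : ¬ (hyp ε).BaseSquareInv :=
  fun ⟨B', _, hc, _⟩ => not_oneCommutes_twist (ε := ε⁻¹) (by rwa [MonoidHom.inv_apply, Ne, inv_eq_one]) B' hc

/-- Row F-2815 HOLDS at `hyp ε`: the twist and its quasi-inverse preserve Frobenius degrees.
[cite: MochizukiEtTh2009, Cor 3.8 p.81] -/
theorem preservesLinear_hyp (ε : ℕ+ →* G) : (hyp ε).PreservesLinear :=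
  ⟨fun _ _ _ h => h, fun _ _ _ h => h⟩

/-- Row F-2816 HOLDS at `hyp ε`: the twist and its quasi-inverse do not change zero divisors, and source and
target carry the SAME structure. [cite: MochizukiEtTh2009, Cor 3.8 p.81] -/
theorem preservesBsFldPreSteps_hyp (ε : ℕ+ →* G) : (hyp ε).PreservesBsFldPreSteps :=
  ⟨fun _ _ _ _ => Iff.rfl, fun _ _ _ _ => Iff.rfl⟩

/-! ### The closures of F-2813 / F-2814 at `G = ℚˣ`, `ε(d) = d` -/

/-- `ε(d) = d ∈ ℚˣ`, a homomorphism `ℕ_{≥1} → ℚˣ` with `ε(2) = 2 ≠ 1`. [folklore] -/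
def epsQ : ℕ+ →* ℚˣ where
  toFun n := Units.mk0 (n : ℚ) (by exact_mod_cast n.ne_zero)
  map_one' := Units.ext (by simp)
  map_mul' m n := Units.ext (by simp)

/-- `ε(2) ≠ 1`. [folklore] -/
private theorem epsQ_two_ne_one : epsQ 2 ≠ 1 := by
  intro h
  have h2 := congrArg Units.val h
  simp [epsQ] at h2

/-- **F-2813 as typed is not a fact over ALL `Cor38Hyp` records:** the universal closure (universe level `0`)
is FALSE.  Instance form: `Cor38Hyp.baseSquare_treeCatVocab_of_isOfFSMType` (abc-iut-f-001, Div-slim FSM-type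
bases at the canonical vocabulary), `baseSquare_of_cor411ii`. [cite: MochizukiEtTh2009, Cor 3.8 p.81] -/
theorem not_forall_baseSquare :
    ¬ ∀ {D₀ : Type} [Category.{0} D₀] {V : FrdIMonoidStub.{0}} {T : RealifiedDivisorMonoids (D₀ := D₀) V}
        {D : Type} [Category.{0} D] {VD : FrdICatStub.{0, 0, 0} D}
        {D₀' : Type} [Category.{0} D₀'] {T' : RealifiedDivisorMonoids (D₀ := D₀') V}
        {D' : Type} [Category.{0} D'] {VD' : FrdICatStub.{0, 0, 0} D'}
        {C₁ : TemperedFrobenioid T D VD} {C₂ : TemperedFrobenioid T' D' VD'} (h : Cor38Hyp C₁ C₂),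
        h.BaseSquare :=
  fun h => not_baseSquare epsQ_two_ne_one (h (hyp epsQ))

/-- **F-2814 as typed is not a fact over ALL `Cor38Hyp` records:** the universal closure (universe level `0`)
is FALSE.  Instance form: `Cor38Hyp.baseSquareInv_treeCatVocab_of_isOfFSMType` (abc-iut-f-001),
`baseSquareInv_of_cor411ii`. [cite: MochizukiEtTh2009, Cor 3.8 p.81] -/
theorem not_forall_baseSquareInv :
    ¬ ∀ {D₀ : Type} [Category.{0} D₀] {V : FrdIMonoidStub.{0}} {T : RealifiedDivisorMonoids (D₀ := D₀) V}
        {D : Type} [Category.{0} D] {VD : FrdICatStub.{0, 0, 0} D}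
        {D₀' : Type} [Category.{0} D₀'] {T' : RealifiedDivisorMonoids (D₀ := D₀') V}
        {D' : Type} [Category.{0} D'] {VD' : FrdICatStub.{0, 0, 0} D'}
        {C₁ : TemperedFrobenioid T D VD} {C₂ : TemperedFrobenioid T' D' VD'} (h : Cor38Hyp C₁ C₂),
        h.BaseSquareInv :=
  fun h => not_baseSquareInv epsQ_two_ne_one (h (hyp epsQ))

end DegreeTwist

end Literature.AnabelianGeometry.EtaleTheta

end
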